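import Summits.KontsevichZagierPeriods.KontsevichZagierPeriods.Theses.HurwitzMicroSectors
import Summits.KontsevichZagierPeriods.KontsevichZagierPeriods.Theorems.HurwitzMicroSectorsAperySectorThreeTwo
import Summits.KontsevichZagierPeriods.KontsevichZagierPeriods.Theorems.HurwitzMicroSectorsRigidityTwoSix
import Summits.KontsevichZagierPeriods.KontsevichZagierPeriods.Theorems.HurwitzMicroSectorsSectorTwoSix
import Literature.NumberTheory.Transcendental.KZProduct
import Literature.NumberTheory.Transcendental.LindemannWeierstrassProofs

/-!
# `HurwitzSectorComplement` (stmt-KontsevichZagierPeriods-14341) — negative side, II: the rung table is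
# infinite by necessity (refuted strengthening of `NormalFormPrinciple`)

Refuter (`cdisprove`, cycle 1) by-product (landed copy of §5/§5b of the crux work file). The route closes
Conjecture 1 one `(weight, level)` rung at a time, each rung a family of normal forms with
finite-dimensional `ℚ`-span of values closed by one linear-independence theorem; the crux is the splice
point "all remaining rungs". NO FINITE splice suffices:

* `piPow k` — the rational representations `[disc]^k × [ℝ⁰, 1]` of value `π^k` (tree `KZ.piRep`,
  `IntegralRep.prod`, `value_piRep_prod`); `not_forall_pi_pow_mem_span` (Lindemann, tree
  `transcendental_pi_holds`, via the determinant trick `isIntegral_of_smul_mem_submodule`);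
* `not_reduction_finiteSpan` — no family with finite-dimensional `ℚ`-span of values is a reduction
  target; `reduction_values_escape`; `not_normalFormPrinciple_finiteSpan`;
  `cruxFiniteSpan_iff_not_sectorTwoSix`, `not_cruxFiniteSpan`;
* concretely `not_reduction_to_closed_rungs` (the `(2,6)` normal forms ∪ the whole `(3,2)` sector, values
  in `span_ℚ {1, π², L(2,χ₋₃), ζ(3)}` by the tree's `value_of_normalForm` / `value_normalForm`) and
  `not_reduction_to_closed_rungs_add_finite` (plus ANY finite list of further constants: Catalan's `G`,
  `π⁴`, `L(4,χ₋₃)`, …). A witness family for `NormalFormPrinciple` needs values of infinite `ℚ`-dimension,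
  i.e. infinitely many independent rigidity inputs.

Sources: M. Kontsevich, D. Zagier, *Periods* (2001), §1.1 eq. (1), §1.2; F. Lindemann (1882) via
A. Baker, *Transcendental Number Theory* (1975), Ch. 1 Thm 1.3; F. Calegari, V. Dimitrov, Y. Tang (2024),
Cor. 2; R. Apéry (1979).
-/

noncomputable section

namespace Summit.KontsevichZagierPeriods.Theorems.HurwitzSectorComplement.Negative

open Set MeasureTheory Polynomial
open Literature.NumberTheory.Transcendental
open Literature.NumberTheory.Transcendental.KZ
open Literature.ModelTheory.ExponentialFields (isSemialgebraic_univ IsSemialgebraic)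
open Summit.KontsevichZagierPeriods.KontsevichZagierPeriods.Theses.HurwitzMicroSectors
  (HurwitzSectorComplement SectorTwoSix AperySectorThreeTwo NormalFormPrinciple closes)

/-! ## §4 Refuted strengthening: the rung table is infinite by necessity -/

/-- The constant representation `[ℝ⁰, 1]` (value `1`, KZ-literal shape). [folklore] -/
def oneRep0 : IntegralRep 0 :=
  IntegralRep.ofRational univ 1 1 isSemialgebraic_univ (fun _ _ => by simp) (by simp)

/-- The `π`-power tower: `piPow 0 = [ℝ⁰, 1]`, `piPow (k+1) = [disc] × piPow k` (tree `KZ.piRep`,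
`IntegralRep.prod`). [cite: KontsevichZagier2001, §1.1 eq. (1)] -/
def piPow : ℕ → Σ n, IntegralRep n
  | 0 => ⟨0, oneRep0⟩
  | k + 1 => ⟨2 + (piPow k).1, piRep.prod (piPow k).2⟩

/-- The integrand of `piPow k` is the constant `1`. [folklore] -/
theorem piPow_integrand (k : ℕ) : ∀ z, (piPow k).2.integrand z = 1 := by
  induction k with
  | zero => intro z; simp [piPow, oneRep0]
  | succ k ih =>
    intro z
    simp [piPow, IntegralRep.prodFun, ih]

/-- `piPow k` has KZ's literal (rational) shape. [folklore] -/
theorem piPow_isRational (k : ℕ) : (piPow k).2.IsRational :=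
  ⟨1, 1, fun _ _ => by simp, fun z _ => by simp [piPow_integrand]⟩

/-- **`value (piPow k) = π ^ k`** (tree `value_piRep_prod`, `piRep_value`). [cite: KontsevichZagier2001, §1.1 eq. (1)] -/
theorem piPow_value (k : ℕ) : (piPow k).2.value = Real.pi ^ k := by
  induction k with
  | zero =>
    simp only [piPow, oneRep0, IntegralRep.value_ofRational, pow_zero]
    simp [MeasureTheory.Measure.real, MeasureTheory.volume_pi]
  | succ k ih =>
    show (piRep.prod (piPow k).2).value = _
    rw [IntegralRep.value_piRep_prod, ih, pow_succ, mul_comm]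

/-- The powers of `π` do not all lie in one finite-dimensional `ℚ`-subspace of `ℝ` (determinant trick
`isIntegral_of_smul_mem_submodule` + Lindemann, tree `transcendental_pi_holds`).
[cite: Lindemann1882, via BakerTNT1975 Ch. 1 Theorem 1.3, p. 5] -/
theorem not_forall_pi_pow_mem_span {S : Set ℝ} (hS : S.Finite)
    (hpow : ∀ k : ℕ, Real.pi ^ k ∈ Submodule.span ℚ S) : False := by
  set V : Submodule ℚ ℝ := Submodule.span ℚ S with hV
  haveI : FiniteDimensional ℚ V := FiniteDimensional.span_of_finite ℚ hS
  set W : Submodule ℚ ℝ := Submodule.span ℚ (Set.range fun k : ℕ => Real.pi ^ k) with hW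
  have hWV : W ≤ V := Submodule.span_le.mpr (by rintro _ ⟨k, rfl⟩; exact hpow k)
  haveI : FiniteDimensional ℚ W := Submodule.finiteDimensional_of_le hWV
  have hfg : W.FG := Module.Finite.iff_fg.mp inferInstance
  have hW0 : W ≠ ⊥ := by
    intro h
    have h1 : (Real.pi ^ 0 : ℝ) ∈ W := Submodule.subset_span ⟨0, rfl⟩
    rw [h, Submodule.mem_bot, pow_zero] at h1
    exact one_ne_zero h1
  have hsmul : ∀ w ∈ W, Real.pi • w ∈ W := by
    intro w hw
    have : W ≤ W.comap (LinearMap.mulLeft ℚ Real.pi) := by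
      refine Submodule.span_le.mpr ?_
      rintro _ ⟨k, rfl⟩
      show Real.pi ^ k ∈ W.comap (LinearMap.mulLeft ℚ Real.pi)
      rw [Submodule.mem_comap, LinearMap.mulLeft_apply, ← pow_succ']
      exact Submodule.subset_span ⟨k + 1, rfl⟩
    simpa using this hw
  have hint : IsIntegral ℚ Real.pi := isIntegral_of_smul_mem_submodule W hW0 hfg Real.pi hsmul
  exact transcendental_pi_holds hint.isAlgebraic

/-- **No reduction to a family with finite-dimensional value span**: if the members of `𝒩` have values
in `span_ℚ S`, `S` finite, then not every rational representation is KZ-equivalent to a member of `𝒩`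
(the `piPow k`; soundness). [folklore] -/
theorem not_reduction_finiteSpan (𝒩 : (n : ℕ) → Set (IntegralRep n)) {S : Set ℝ} (hS : S.Finite)
    (hval : ∀ n (N : IntegralRep n), N ∈ 𝒩 n → N.value ∈ Submodule.span ℚ S)
    (hred : ∀ (n : ℕ) (r : IntegralRep n), r.IsRational →
      ∃ (m : ℕ) (N : IntegralRep m), N ∈ 𝒩 m ∧ Equivalent r N) : False := by
  refine not_forall_pi_pow_mem_span hS fun k => ?_
  obtain ⟨m, N, hN, hrN⟩ := hred _ (piPow k).2 (piPow_isRational k)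
  rw [← piPow_value k, Equivalent.value_eq_holds hrN]
  exact hval m N hN

/-- A reducing family takes, for every finite `S`, a value outside `span_ℚ S`: rigidity on it needs
infinitely many independent linear-independence inputs. [folklore] -/
theorem reduction_values_escape (𝒩 : (n : ℕ) → Set (IntegralRep n))
    (hred : ∀ (n : ℕ) (r : IntegralRep n), r.IsRational →
      ∃ (m : ℕ) (N : IntegralRep m), N ∈ 𝒩 m ∧ Equivalent r N)
    {S : Set ℝ} (hS : S.Finite) : ∃ (n : ℕ) (N : IntegralRep n), N ∈ 𝒩 n ∧ N.value ∉ Submodule.span ℚ S := by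
  by_contra h
  push Not at h
  exact not_reduction_finiteSpan 𝒩 hS h hred

/-- **The strengthened normal-form principle is FALSE**: there is no normal-form family with
finite-dimensional `ℚ`-span of values satisfying rigidity and reduction (the rigidity clause is not even
used). [folklore] -/
theorem not_normalFormPrinciple_finiteSpan :
    ¬ ∃ (𝒩 : (n : ℕ) → Set (IntegralRep n)) (S : Set ℝ), S.Finite ∧
      (∀ n (N : IntegralRep n), N ∈ 𝒩 n → N.value ∈ Submodule.span ℚ S) ∧
      (∀ (n m : ℕ) (N : IntegralRep n) (N' : IntegralRep m), N ∈ 𝒩 n → N' ∈ 𝒩 m →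
        N.value = N'.value → Equivalent N N') ∧
      (∀ (n : ℕ) (r : IntegralRep n), r.IsRational →
        ∃ (m : ℕ) (N : IntegralRep m), N ∈ 𝒩 m ∧ Equivalent r N) :=
  fun ⟨𝒩, _, hS, hval, _, hred⟩ => not_reduction_finiteSpan 𝒩 hS hval hred

/-- The crux with this strengthened conclusion is equivalent to `¬ SectorTwoSix` — false, the sector being
the tree theorem `SectorTwoSix_of`; so the strengthened crux is refuted (`not_cruxFiniteSpan`) as a
STRENGTHENING, which is not a refutation of the item. [folklore] -/
theorem cruxFiniteSpan_iff_not_sectorTwoSix :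
    (SectorTwoSix → AperySectorThreeTwo →
      ∃ (𝒩 : (n : ℕ) → Set (IntegralRep n)) (S : Set ℝ), S.Finite ∧
        (∀ n (N : IntegralRep n), N ∈ 𝒩 n → N.value ∈ Submodule.span ℚ S) ∧
        (∀ (n m : ℕ) (N : IntegralRep n) (N' : IntegralRep m), N ∈ 𝒩 n → N' ∈ 𝒩 m →
          N.value = N'.value → Equivalent N N') ∧
        (∀ (n : ℕ) (r : IntegralRep n), r.IsRational →
          ∃ (m : ℕ) (N : IntegralRep m), N ∈ 𝒩 m ∧ Equivalent r N)) ↔ ¬ SectorTwoSix :=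
  ⟨fun h h1 => not_normalFormPrinciple_finiteSpan
      (h h1 Summit.KontsevichZagierPeriods.Theorems.AperySectorThreeTwo.AperySectorThreeTwo_of),
    fun h h1 _ => absurd h1 h⟩

/-- The crux with the finite-span conclusion is FALSE. [folklore] -/
theorem not_cruxFiniteSpan :
    ¬ (SectorTwoSix → AperySectorThreeTwo →
      ∃ (𝒩 : (n : ℕ) → Set (IntegralRep n)) (S : Set ℝ), S.Finite ∧
        (∀ n (N : IntegralRep n), N ∈ 𝒩 n → N.value ∈ Submodule.span ℚ S) ∧
        (∀ (n m : ℕ) (N : IntegralRep n) (N' : IntegralRep m), N ∈ 𝒩 n → N' ∈ 𝒩 m →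
          N.value = N'.value → Equivalent N N') ∧
        (∀ (n : ℕ) (r : IntegralRep n), r.IsRational →
          ∃ (m : ℕ) (N : IntegralRep m), N ∈ 𝒩 m ∧ Equivalent r N)) :=
  fun h => cruxFiniteSpan_iff_not_sectorTwoSix.mp h
    Summit.KontsevichZagierPeriods.Theorems.HurwitzMicroSectorsSectorTwoSix.SectorTwoSix_of

/-! ### §4b The route's two closed rungs, concretely -/

/-- The `(2,6)` normal forms of the route: representations on the open box `(0,1)²` with integrand
`a + b/(1−xy) + c/(1+xy+x²y²)` there, `a b c ∈ ℚ`. [cite: CalegariDimitrovTang2024, Cor. 2] -/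
def TwoSixNormalForms : Set (IntegralRep 2) :=
  {N | ∃ a b c : ℚ, N.domain = {x | ∀ i, x i ∈ Set.Ioo (0:ℝ) 1} ∧
    EqOn N.integrand (fun x => (a : ℝ) + b / (1 - x 0 * x 1) + c / (1 + x 0 * x 1 + (x 0 * x 1) ^ 2))
      N.domain}

/-- The `(3,2)` sector of `AperySectorThreeTwo`: representations on the open box `(0,1)³` with integrand
`P(xyz)/(1 − (xyz)²)` there, `P ∈ ℚ[t]`. [cite: Apery1979] -/
def ThreeTwoSector : Set (IntegralRep 3) :=
  {N | ∃ P : ℚ[X], N.domain = {x | ∀ i, x i ∈ Set.Ioo (0:ℝ) 1} ∧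
    EqOn N.integrand (fun x => Polynomial.aeval (x 0 * x 1 * x 2) P / (1 - (x 0 * x 1 * x 2) ^ 2))
      N.domain}

/-- `q * x = q • x` for the `ℚ`-module structure of `ℝ`. [folklore] -/
theorem ratCast_mul_eq_smul (q : ℚ) (x : ℝ) : (q : ℝ) * x = q • x := (Rat.smul_def q x).symm

/-- Values of `(2,6)` normal forms lie in `span_ℚ {1, π², L(2,χ₋₃)}` (tree `value_of_normalForm`). [cite: CalegariDimitrovTang2024, Cor. 2] -/
theorem value_mem_span_of_mem_twoSix {N : IntegralRep 2} (hN : N ∈ TwoSixNormalForms) :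
    N.value ∈ Submodule.span ℚ ({1, Real.pi ^ 2, L2chi3} : Set ℝ) := by
  obtain ⟨a, b, c, hd, hi⟩ := hN
  rw [Summit.KontsevichZagierPeriods.Theorems.HurwitzMicroSectorsRigidityTwoSix.value_of_normalForm
    a b c N hd hi]
  have h1 : (1 : ℝ) ∈ Submodule.span ℚ ({1, Real.pi ^ 2, L2chi3} : Set ℝ) :=
    Submodule.subset_span (by simp)
  have h2 : Real.pi ^ 2 ∈ Submodule.span ℚ ({1, Real.pi ^ 2, L2chi3} : Set ℝ) :=
    Submodule.subset_span (by simp)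
  have h3 : L2chi3 ∈ Submodule.span ℚ ({1, Real.pi ^ 2, L2chi3} : Set ℝ) :=
    Submodule.subset_span (by simp)
  refine Submodule.add_mem _ (Submodule.add_mem _ ?_ ?_) ?_
  · have : ((a : ℚ) : ℝ) = a • (1 : ℝ) := by rw [← ratCast_mul_eq_smul, mul_one]
    rw [this]; exact Submodule.smul_mem _ _ h1
  · have : ((b : ℚ) : ℝ) * (Real.pi ^ 2 / 6) = (b / 6 : ℚ) • Real.pi ^ 2 := by
      rw [← ratCast_mul_eq_smul]; push_cast; ring
    rw [this]; exact Submodule.smul_mem _ _ h2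
  · rw [ratCast_mul_eq_smul]; exact Submodule.smul_mem _ _ h3

/-- Values of the `(3,2)` sector lie in `span_ℚ {1, ζ(3)}` (tree reduction stubs + `value_normalForm`,
soundness). [cite: Apery1979] -/
theorem value_mem_span_of_mem_threeTwo {N : IntegralRep 3} (hN : N ∈ ThreeTwoSector) :
    N.value ∈ Submodule.span ℚ ({1, zetaValue 3} : Set ℝ) := by
  obtain ⟨P, hd, hi⟩ := hN
  have e1 := Summit.KontsevichZagierPeriods.Theorems.AperySectorThreeTwo.of_sub_of_sectorRep_mem hd hi
  obtain ⟨a, b, e2⟩ :=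
    Summit.KontsevichZagierPeriods.Theorems.AperySectorThreeTwo.stub_normalFormReduction
      Summit.KontsevichZagierPeriods.Theorems.AperySectorThreeTwo.stub_monomialFlatten
      Summit.KontsevichZagierPeriods.Theorems.AperySectorThreeTwo.stub_polarDistribution P
  rw [Equivalent.value_eq_holds e1, Equivalent.value_eq_holds e2,
    Summit.KontsevichZagierPeriods.Theorems.AperySectorThreeTwo.value_normalForm]
  have h1 : (1 : ℝ) ∈ Submodule.span ℚ ({1, zetaValue 3} : Set ℝ) := Submodule.subset_span (by simp)
  have h3 : zetaValue 3 ∈ Submodule.span ℚ ({1, zetaValue 3} : Set ℝ) := Submodule.subset_span (by simp)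
  refine Submodule.add_mem _ ?_ ?_
  · have : ((a : ℚ) : ℝ) = a • (1 : ℝ) := by rw [← ratCast_mul_eq_smul, mul_one]
    rw [this]; exact Submodule.smul_mem _ _ h1
  · have : ((b : ℚ) : ℝ) * (1 / 8 * zetaValue 3) = (b / 8 : ℚ) • zetaValue 3 := by
      rw [← ratCast_mul_eq_smul]; push_cast; ring
    rw [this]; exact Submodule.smul_mem _ _ h3

/-- The union of the two closed rungs as a candidate normal-form family. [folklore] -/
def closedRungs : (n : ℕ) → Set (IntegralRep n)
  | 2 => TwoSixNormalForms
  | 3 => ThreeTwoSector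
  | _ => ∅

/-- Every member of the closed rungs has value in `span_ℚ {1, π², L(2,χ₋₃), ζ(3)}`. [folklore] -/
theorem value_mem_span_of_mem_closedRungs {n : ℕ} {N : IntegralRep n} (hN : N ∈ closedRungs n) :
    N.value ∈ Submodule.span ℚ ({1, Real.pi ^ 2, L2chi3, zetaValue 3} : Set ℝ) := by
  match n, N, hN with
  | 0, _, hN => exact absurd hN (Set.notMem_empty _)
  | 1, _, hN => exact absurd hN (Set.notMem_empty _)
  | 2, N, hN =>
    refine Submodule.span_mono ?_ (value_mem_span_of_mem_twoSix hN)
    intro x hx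
    simp only [Set.mem_insert_iff, Set.mem_singleton_iff] at hx ⊢
    tauto
  | 3, N, hN =>
    refine Submodule.span_mono ?_ (value_mem_span_of_mem_threeTwo hN)
    intro x hx
    simp only [Set.mem_insert_iff, Set.mem_singleton_iff] at hx ⊢
    tauto
  | n + 4, _, hN => exact absurd hN (Set.notMem_empty _)

/-- **The two closed rungs are not a reduction target**: some rational representation is
KZ-equivalent to no `(2,6)` normal form and to no member of the `(3,2)` sector. [folklore] -/
theorem not_reduction_to_closed_rungs :
    ¬ ∀ (n : ℕ) (r : IntegralRep n), r.IsRational →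
      ∃ (m : ℕ) (N : IntegralRep m), N ∈ closedRungs m ∧ Equivalent r N :=
  fun hred => not_reduction_finiteSpan closedRungs
    (((Set.finite_singleton _).insert _).insert _ |>.insert _)
    (fun _ _ hN => value_mem_span_of_mem_closedRungs hN) hred

/-- … nor is any finite enlargement: adjoin finitely many further rungs `ℳ` with values in the span of a
finite list `T` of constants — reduction still fails. [folklore] -/
theorem not_reduction_to_closed_rungs_add_finite (ℳ : (n : ℕ) → Set (IntegralRep n)) {T : Set ℝ}
    (hT : T.Finite) (hℳ : ∀ n (N : IntegralRep n), N ∈ ℳ n → N.value ∈ Submodule.span ℚ T) :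
    ¬ ∀ (n : ℕ) (r : IntegralRep n), r.IsRational →
      ∃ (m : ℕ) (N : IntegralRep m), N ∈ closedRungs m ∪ ℳ m ∧ Equivalent r N := by
  intro hred
  refine not_reduction_finiteSpan (fun m => closedRungs m ∪ ℳ m)
    (S := ({1, Real.pi ^ 2, L2chi3, zetaValue 3} : Set ℝ) ∪ T)
    ((((Set.finite_singleton _).insert _).insert _ |>.insert _).union hT) ?_ hred
  rintro n N (hN | hN)
  · exact Submodule.span_mono Set.subset_union_left (value_mem_span_of_mem_closedRungs hN)
  · exact Submodule.span_mono Set.subset_union_right (hℳ n N hN)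


end Summit.KontsevichZagierPeriods.Theorems.HurwitzSectorComplement.Negative
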